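import Summits.BirchSwinnertonDyer.Rank1Residual.Supersingular.ShaAnOfLOneBall
import HarnessLib

/-!
# `ord_p #Ш_an = k` EXACTLY from the level-one enclosure `hball0` (the equality form of `ShaAnOfLOneBall.lean`)

Cell `b2b-bsdres`, supersingular family, prover A = unit `b2b-bsdres-x10b` (gen 24).  TOOL, THEOREMS ONLY (2); no definition,
no named fact introduced, nothing booked.

HONEST FRAMING (run/shared/lean/b2b/bsd-rank1-residual/, verbatim in every file): the goal of the cell is to
DELETE the COMBINATION-SHAPED residual classes of the Birch–Swinnerton-Dyer formula for ALL analytic-rank `≤ 1`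
elliptic curves over `ℚ` — "full BSD formula for every rank `≤ 1` curve in class `C`" assembled STRICTLY from
published theorems — so that the rank-`≤ 1` remainder becomes exactly the CONSTRUCTION-SHAPED classes, which are
TYPED (missing-input `Prop`s), NOT attempted.  This is not "finishing BSD".

## What

Gen 22's `exists_shaAn_eq_of_LOneBall` already gives the EXACT valuation `ord_p #Ш_an = ord_p I − ord_p(den·c_∞) −
ord_p ∏c_ℓ` of the rational `#Ш_an` reconstructed from the engine's level-one enclosure of `T₀ = L(E,1)/ω₁ = I/den`;
its record form `analyticRank_shaAn_of_LOneBall_of_rowCheckZ` exported only the INEQUALITY `ord_p q ≤ k` (what Wuthrich's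
upper half consumes).  The Cha / Heegner-index upper half of `X7VisibilityChaNonSurj.lean` (x10b gen 24) consumes the
EQUALITY `ord_p q = 2`.  Here: `exists_shaAn_padicValRat_eq_of_LOneBall` and the record form
`analyticRank_shaAn_eq_of_LOneBall_of_rowCheckZ` — the `≤ k` theorems with the two converse side conditions added
(`p^(m+1) ∤ den·c·∏c` and `p^(m+k) ∣ I`, both `decide` on numerals), concluding `r_an = 0 ∧ ∃ q, #Ш_an = q ∧ ord_p q = k`.

References: [Miller2011LMS] §1, Def. 1.1; [GreenbergVatsal2000] §3 Rem. 3.4; [Serre1972] §1.11 Prop. 12; [Silverman1994] IV.9.4.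
-/

set_option autoImplicit false

noncomputable section

open scoped MatrixGroups ModularForm

open CongruenceSubgroup WeierstrassCurve Literature.NumberTheory.EllipticCurves
  Literature.NumberTheory.EllipticCurves.ModularForms
  Literature.NumberTheory.EllipticCurves.Rank1Residual
  Summit.BirchSwinnertonDyer.Rank1Residual.Supersingular.KuriharaTwist
  Summit.BirchSwinnertonDyer.BirchSwinnertonDyer.Rank2Observatory.Tam
  Summit.BirchSwinnertonDyer.Rank1Residual.Additive.IntModelTam

namespace Summit.BirchSwinnertonDyer.Rank1Residual.Supersingular

/-- **`r_an = 0` and `#Ш_an = q ∈ ℚ` with `ord_p q = k` EXACTLY** from the level-one enclosure: under the hypotheses of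
`exists_shaAn_eq_of_LOneBall` (`p ≥ 5` good with `E[p]` irreducible, `hϖ`, `hGZK`, the newform `f`, `8p(Mr + R) < 1`,
`hball0`), if `p^m ∥ den·c·∏c_ℓ(W)` (`hm`, `hm'`) and `p^(m+k) ∥ I` (`hk'`, `hk`) then `ord_p #Ш_an = (m + k) − m = k`.
The equality twin of `exists_shaAn_padicValRat_le_of_LOneBall` (gen 22).  Per pair; nothing booked.
[cite: Miller2011LMS, §1 and Def. 1.1 (arXiv:1010.2431 p. 3)] [cite: GreenbergVatsal2000, §3, Remark 3.4] -/
theorem exists_shaAn_padicValRat_eq_of_LOneBall (hϖ : realPeriodRat_eq_unit_mul_plusPeriod)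
    (hGZK : rank_eq_analyticRank_of_analyticRank_le_one)
    (W : WeierstrassCurve ℚ) [W.IsElliptic] [W.IsGloballyMinimal] (p : ℕ) [Fact p.Prime] (hp : 5 ≤ p)
    (hgood : W.HasGoodReductionAtPrime p) (hirr : W.HasIrreducibleModPGaloisRep p)
    {N : ℕ} [NeZero N] (f : CuspForm (Gamma0 N) 2) (hf : IsNewformOf W f)
    (R Mr : ℝ) (den c : ℕ) (hD : 0 < den * c) (I : ℤ) (hsmall : 8 * (p : ℝ) * (Mr + R) < 1)
    (hball0 : ∃ mid rad : ℝ, rad ≤ R ∧ |mid - ((I : ℤ) : ℝ)| ≤ Mr ∧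
      |(den : ℝ) * ((c : ℝ) * ((W.entireLFunction 1).re / plusPeriod f)) - mid| ≤ rad)
    (m k : ℕ) (hm : p ^ m ∣ den * c * W.tamagawaProduct) (hm' : ¬ p ^ (m + 1) ∣ den * c * W.tamagawaProduct)
    (hk : ¬ (p : ℤ) ^ (m + k + 1) ∣ I) (hk' : (p : ℤ) ^ (m + k) ∣ I) :
    W.analyticRank = 0 ∧ ∃ q : ℚ, shaAn W = (q : ℂ) ∧ padicValRat p q = k := by
  have hpP : p.Prime := Fact.out
  have hI : I ≠ 0 := by
    rintro rfl
    exact hk (dvd_zero _)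
  have hR1 : R + Mr < 1 := by
    have h1 : (1 : ℝ) ≤ p := by exact_mod_cast hpP.one_lt.le
    by_cases h0 : 0 ≤ Mr + R
    · nlinarith
    · linarith
  refine ⟨analyticRank_eq_zero_of_LOneBall f R Mr den c I hI hR1 hball0, ?_⟩
  obtain ⟨q, hq, hv⟩ :=
    exists_shaAn_eq_of_LOneBall hϖ hGZK W p hp hgood hirr f hf R Mr den c hD I hI hsmall hball0
  refine ⟨q, hq, ?_⟩
  have hcT : 0 < W.tamagawaProduct := W.tamagawaProduct_pos'
  have hprod : 0 < den * c * W.tamagawaProduct := Nat.mul_pos hD hcT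
  -- `m = v_p(den c) + v_p(∏c)` and `v_p(I) = m + k`
  have h1 : m ≤ padicValNat p (den * c) + padicValNat p W.tamagawaProduct := by
    have := (padicValNat_dvd_iff_le hprod.ne').mp hm
    rwa [padicValNat.mul hD.ne' hcT.ne'] at this
  have h1b : padicValNat p (den * c) + padicValNat p W.tamagawaProduct ≤ m := by
    have : ¬ m + 1 ≤ padicValNat p (den * c * W.tamagawaProduct) :=
      fun h ↦ hm' ((padicValNat_dvd_iff_le hprod.ne').mpr h)
    rw [padicValNat.mul hD.ne' hcT.ne'] at this
    omega
  have h2 : padicValInt p I ≤ m + k := by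
    by_contra hlt
    rw [not_le] at hlt
    exact hk ((padicValInt_dvd_iff _ _).mpr (Or.inr (by omega)))
  have h2b : m + k ≤ padicValInt p I := by
    rcases (padicValInt_dvd_iff _ _).mp hk' with h0 | hle
    · exact absurd h0 hI
    · exact hle
  rw [hv]
  push_cast
  have h1' : (m : ℤ) ≤ (padicValNat p (den * c) : ℤ) + (padicValNat p W.tamagawaProduct : ℤ) := by
    exact_mod_cast h1
  have h1b' : (padicValNat p (den * c) : ℤ) + (padicValNat p W.tamagawaProduct : ℤ) ≤ (m : ℤ) := by
    exact_mod_cast h1b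
  have h2' : (padicValInt p I : ℤ) ≤ (m : ℤ) + (k : ℤ) := by exact_mod_cast h2
  have h2b' : (m : ℤ) + (k : ℤ) ≤ (padicValInt p I : ℤ) := by exact_mod_cast h2b
  linarith

/-- **THE RECORD FORM, equality version (good supersingular `p ≥ 5`).**  As `analyticRank_shaAn_of_LOneBall_of_rowCheckZ`
(integral model `W₀`, Tate-algorithm ROW CERTIFICATE `(Es, Xs, Zs)` with `∏c_ℓ(W) = rowValueZ Es Xs Zs`) plus the converse
side conditions `p^(m+1) ∤ den·c·rowValueZ` and `p^(m+k) ∣ I`: `r_an(W) = 0` and `#Ш_an(W) = q ∈ ℚ` with `ord_p q = k`.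
Every side condition is a `decide`.  Consumer: the Cha-route offer on `363312bl1 @ 5` (`ord_5 #Ш_an = 2`).  Per pair;
nothing booked. [cite: Miller2011LMS, §1 and Def. 1.1 (arXiv:1010.2431 p. 3)] [cite: Serre1972, §1.11 Prop. 12]
[cite: Silverman1994, IV.9.4] [cite: GreenbergVatsal2000, §3, Remark 3.4] -/
theorem analyticRank_shaAn_eq_of_LOneBall_of_rowCheckZ (hϖ : realPeriodRat_eq_unit_mul_plusPeriod)
    (hGZK : rank_eq_analyticRank_of_analyticRank_le_one)
    (W : WeierstrassCurve ℚ) [W.IsElliptic] [W.IsGloballyMinimal] (p : ℕ) [Fact p.Prime] (hp : 5 ≤ p)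
    (hss : GoodSS W p) {N : ℕ} [NeZero N] (f : CuspForm (Gamma0 N) 2) (hf : IsNewformOf W f)
    (R Mr : ℝ) (den c : ℕ) (hD : 0 < den * c) (I : ℤ) (hsmall : 8 * (p : ℝ) * (Mr + R) < 1)
    (hball0 : ∃ mid rad : ℝ, rad ≤ R ∧ |mid - ((I : ℤ) : ℝ)| ≤ Mr ∧
      |(den : ℝ) * ((c : ℝ) * ((W.entireLFunction 1).re / plusPeriod f)) - mid| ≤ rad)
    {W₀ : WeierstrassCurve ℤ} (hIW : integralModelInt W = W₀) {Es : List TamLocal} {Xs : List TamX}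
    {Zs : List TamZ} (hrow : TamZ.rowCheckZ Es Xs Zs W₀ = true) (hx : TamZ.rowExactZ Es Xs Zs = true)
    (m k : ℕ) (hm : p ^ m ∣ den * c * TamZ.rowValueZ Es Xs Zs) (hm' : ¬ p ^ (m + 1) ∣ den * c * TamZ.rowValueZ Es Xs Zs)
    (hk : ¬ (p : ℤ) ^ (m + k + 1) ∣ I) (hk' : (p : ℤ) ^ (m + k) ∣ I) :
    W.analyticRank = 0 ∧ ∃ q : ℚ, shaAn W = (q : ℂ) ∧ padicValRat p q = k := by
  have hp2 : p ≠ 2 := by omega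
  have hirr : W.HasIrreducibleModPGaloisRep p :=
    hasIrreducibleModPGaloisRep_of_dvd_frobeniusTrace W p hp2
      (W.not_dvd_minimalDiscriminantInt_of_hasGoodReductionAtPrime' p hss.1) hss.2
  have hT : W.tamagawaProduct = TamZ.rowValueZ Es Xs Zs := tamagawaProduct_eq_rowValueZ_of_intModel hIW hrow hx
  exact exists_shaAn_padicValRat_eq_of_LOneBall hϖ hGZK W p hp hss.1 hirr f hf R Mr den c hD I hsmall hball0 m k
    (by rw [hT]; exact hm) (by rw [hT]; exact hm') hk hk'

end Summit.BirchSwinnertonDyer.Rank1Residual.Supersingular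

end
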